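import Mathlib
import Summits.ValiantsHypothesis.ValiantsHypothesis.Theorems.KPlusLogSqLawLiftingLocalDescartesOneSided

/-!
# The local Descartes rule along a chain of dominance points: the DISTRIBUTION LAW and exactness without hidden exponents

HONEST FRAMING.  Helper file toward the lifting crux `WeakLifting` (stmt-ValiantsHypothesis-19561; aside `Lifting`
stmt-ValiantsHypothesis-19772, registered stub `stub_liftThin`) of route `KPlusLogSqLaw` (cell `pub-symmetroid`, seat
val-sym-lift-p1 g9, 2026-08-27).  Elementary facts about ONE real polynomial; nothing here asserts `WeakLifting`, `TropicalB`,
Conjecture B, `MatrixDescartes` (stmt-ValiantsHypothesis-18050) or anything about VP ≠ VNP.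

CONTENT (`x^u` DOMINATES `f = Σ c_i X^i` at `a > 0` iff `Σ_{i ≠ u} |c_i| a^i < |c_u| a^u`):
* `root_trichotomy_of_chain` — relative to a chain `0 < a_0 < ⋯ < a_r` of dominance points a zero of `f` lies below `a_0`, strictly
  between two consecutive points, or above `a_r` (never AT a dominance point);
* `card_posRoots_le_sum_signVar` — the DISTRIBUTION LAW: along a chain of dominance points with exponents `u_0, …, u_r` the
  distinct positive zeros number at most `Var(c_0..c_{u_0}) + Σ_k Var(c_{u_k}..c_{u_{k+1}}) + Var(c_{u_r}..c_n)` — each window is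
  counted by ITS OWN sign changes (a certificate shape for window-by-window root counting; summed up it is Descartes' count
  again: the law redistributes it over the archimedean Newton polygon and never beats it on a format — GAP-LIFT §3 (M1) of
  val-sym-lift-p4);
* `card_posRoots_eq_card_alternating_of_chain` — EXACTNESS WITHOUT HIDDEN EXPONENTS: if the chain's exponents span the support and
  no support exponent lies strictly between two consecutive `u_k`, the number of distinct positive zeros EQUALS
  `#{k : c_{u_k} c_{u_{k+1}} < 0}` (upper half: the distribution law; lower half: the intermediate value theorem on each
  alternating window, the tree's `ExactPatchwork.card_alternating_le_card_posRoots`).  Compared with lift-p2's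
  `ExactPatchwork.card_posRoots_eq_card_alternating` this needs NO derivative margin (M) and only ONE dominance point per vertex,
  at the price of excluding interior exponents (with interior exponents the loss is exactly the local `Var`).
The design-level corollary (patchworked pencils of a tropical design at finite base) is the companion
`…LiftingFiniteBasePatchwork`.  No `def`.  [folklore]
-/

set_option linter.dupNamespace false
set_option autoImplicit false

namespace Summit.ValiantsHypothesis.ValiantsHypothesis.Theorems.KPlusLogSqLaw.LocalDescartes

open Set Finset Polynomial
open scoped BigOperators
open Literature.Algebra.Polynomial (signVar signVarAux)
open Summit.ValiantsHypothesis.ValiantsHypothesis.Theorems.KPlusLogSqLaw.ExactPatchwork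
  (mul_eval_pos_of_dominant card_alternating_le_card_posRoots)

/-! ## The distribution law along a chain of dominance points -/

/-- **localisation of a positive zero relative to a chain of dominance points**: it lies below the first point, strictly
between two consecutive points, or above the last one (it is never AT a dominance point). [folklore] -/
theorem root_trichotomy_of_chain (f : ℝ[X]) (r : ℕ) (u : Fin (r + 1) → ℕ) (a : Fin (r + 1) → ℝ)
    (ha : StrictMono a) (ha0 : 0 < a 0)
    (hdom : ∀ k, ∑ i ∈ f.support.erase (u k), |f.coeff i| * a k ^ i < |f.coeff (u k)| * a k ^ (u k))
    {t : ℝ} (hroot : f.eval t = 0) :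
    t < a 0 ∨ (∃ k : Fin r, a k.castSucc < t ∧ t < a k.succ) ∨ a (Fin.last r) < t := by
  classical
  have hne : ∀ k, t ≠ a k := by
    intro k h
    have hk0 : 0 < a k := lt_of_lt_of_le ha0 (ha.monotone (Fin.zero_le _))
    have := mul_eval_pos_of_dominant f hk0 (hdom k)
    rw [← h, hroot, mul_zero] at this
    exact lt_irrefl _ this
  by_cases h0 : t < a 0
  · exact Or.inl h0
  by_cases hr : a (Fin.last r) < t
  · exact Or.inr (Or.inr hr)
  right; left
  have h0' : a 0 < t := lt_of_le_of_ne (not_lt.mp h0) (fun h => hne 0 h.symm)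
  have hr' : t < a (Fin.last r) := lt_of_le_of_ne (not_lt.mp hr) (hne _)
  set T := (Finset.univ : Finset (Fin (r + 1))).filter (fun j => a j < t) with hT
  have hTne : T.Nonempty := ⟨0, Finset.mem_filter.mpr ⟨Finset.mem_univ _, h0'⟩⟩
  set j := T.max' hTne with hj
  have hjT : j ∈ T := Finset.max'_mem T hTne
  have hjt : a j < t := (Finset.mem_filter.mp hjT).2
  have hjlast : j ≠ Fin.last r := by
    intro h; rw [h] at hjt; exact lt_asymm hjt hr'
  set k : Fin r := j.castPred hjlast with hk
  have hkj : k.castSucc = j := Fin.castSucc_castPred j hjlast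
  refine ⟨k, by rw [hkj]; exact hjt, ?_⟩
  by_contra hcon
  have hlt : a k.succ < t := lt_of_le_of_ne (not_lt.mp hcon) (fun h => hne _ h.symm)
  have hmem : k.succ ∈ T := Finset.mem_filter.mpr ⟨Finset.mem_univ _, hlt⟩
  have hle : k.succ ≤ j := Finset.le_max' T _ hmem
  have : k.castSucc < k.succ := Fin.castSucc_lt_succ
  rw [hkj] at this
  exact absurd hle (not_le.mpr this)

/-- **DISTRIBUTION LAW (local Descartes certificate along a chain).**  Let `0 < a_0 < a_1 < ⋯ < a_r` be points at which the
monomials `x^{u_0}, …, x^{u_r}` dominate `f`.  Then the number of distinct positive zeros of `f` is at most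
`Var(c_0..c_{u_0}) + Σ_{k<r} Var(c_{u_k}..c_{u_{k+1}}) + Var(c_{u_r}..c_n)`: every window between consecutive dominance points is
counted by its OWN coefficient sign changes (the exponents `u_k` increase automatically, `le_of_dominant_of_lt`).  Summed up
this is Descartes' count again (the law redistributes it over the archimedean Newton polygon, GAP-LIFT §3 (M1)); its use is as a
window-by-window certificate. [folklore] -/
theorem card_posRoots_le_sum_signVar (f : ℝ[X]) (r : ℕ) (u : Fin (r + 1) → ℕ) (a : Fin (r + 1) → ℝ)
    (ha : StrictMono a) (ha0 : 0 < a 0)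
    (hdom : ∀ k, ∑ i ∈ f.support.erase (u k), |f.coeff i| * a k ^ i < |f.coeff (u k)| * a k ^ (u k)) :
    (f.roots.toFinset.filter (fun t => 0 < t)).card ≤
      signVar ((List.range (u 0 + 1)).map f.coeff)
      + ∑ k : Fin r, signVar ((List.range (u k.succ + 1 - u k.castSucc)).map (fun i => f.coeff (u k.castSucc + i)))
      + signVar ((List.range (f.natDegree + 1 - u (Fin.last r))).map (fun i => f.coeff (u (Fin.last r) + i))) := by
  classical
  have hapos : ∀ k, 0 < a k := fun k => lt_of_lt_of_le ha0 (ha.monotone (Fin.zero_le _))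
  have hcu : ∀ k, f.coeff (u k) ≠ 0 := fun k => coeff_ne_zero_of_dominant f (hapos k) (hdom k)
  have hf : f ≠ 0 := fun h => hcu 0 (by rw [h, Polynomial.coeff_zero])
  set S := f.roots.toFinset.filter (fun t => 0 < t) with hS
  set Slow := f.roots.toFinset.filter (fun x => 0 < x ∧ x < a 0) with hSlow
  set Smid : Fin r → Finset ℝ := fun k => f.roots.toFinset.filter (fun x => a k.castSucc < x ∧ x < a k.succ) with hSmid
  set Shigh := f.roots.toFinset.filter (fun x => a (Fin.last r) < x) with hShigh
  have hcover : S ⊆ Slow ∪ (Finset.univ.biUnion Smid) ∪ Shigh := by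
    intro t ht
    rw [Finset.mem_filter] at ht
    have ht0 : 0 < t := ht.2
    have hroot : f.eval t = 0 := by
      have := ht.1
      rw [Multiset.mem_toFinset, Polynomial.mem_roots hf] at this
      exact this
    rcases root_trichotomy_of_chain f r u a ha ha0 hdom hroot with h1 | ⟨k, hk1, hk2⟩ | h3
    · exact Finset.mem_union_left _ (Finset.mem_union_left _ (Finset.mem_filter.mpr ⟨ht.1, ht0, h1⟩))
    · refine Finset.mem_union_left _ (Finset.mem_union_right _ ?_)
      rw [Finset.mem_biUnion]
      exact ⟨k, Finset.mem_univ _, Finset.mem_filter.mpr ⟨ht.1, hk1, hk2⟩⟩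
    · exact Finset.mem_union_right _ (Finset.mem_filter.mpr ⟨ht.1, h3⟩)
  have hlow : Slow.card ≤ signVar ((List.range (u 0 + 1)).map f.coeff) :=
    card_roots_lt_le_signVar f (hapos 0) (hdom 0)
  have hmid : ∀ k : Fin r, (Smid k).card
      ≤ signVar ((List.range (u k.succ + 1 - u k.castSucc)).map (fun i => f.coeff (u k.castSucc + i))) := by
    intro k
    have hlt : a k.castSucc < a k.succ := ha Fin.castSucc_lt_succ
    exact card_roots_Ioo_le_signVar_coeffs f (hapos _) hlt
      (le_of_dominant_of_lt f (hapos _) hlt (hdom _) (hdom _)) (hdom _) (hdom _)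
  have hhigh : Shigh.card
      ≤ signVar ((List.range (f.natDegree + 1 - u (Fin.last r))).map (fun i => f.coeff (u (Fin.last r) + i))) :=
    card_roots_gt_le_signVar f (hapos _) (hdom _)
  calc S.card ≤ (Slow ∪ (Finset.univ.biUnion Smid) ∪ Shigh).card := Finset.card_le_card hcover
    _ ≤ (Slow ∪ (Finset.univ.biUnion Smid)).card + Shigh.card := Finset.card_union_le _ _
    _ ≤ (Slow.card + (Finset.univ.biUnion Smid).card) + Shigh.card :=
        Nat.add_le_add_right (Finset.card_union_le _ _) _
    _ ≤ (Slow.card + ∑ k, (Smid k).card) + Shigh.card :=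
        Nat.add_le_add_right (Nat.add_le_add_left Finset.card_biUnion_le _) _
    _ ≤ _ := Nat.add_le_add (Nat.add_le_add hlow (Finset.sum_le_sum fun k _ => hmid k)) hhigh

/-- **EXACT COUNT ALONG A CHAIN WITHOUT HIDDEN EXPONENTS.**  Let `0 < a_0 < ⋯ < a_r` be dominance points of `x^{u_0}, …, x^{u_r}`
such that every exponent of the support lies in `[u_0, u_r]` and none lies strictly between two consecutive `u_k`.  Then the
number of distinct positive zeros of `f` is EXACTLY `#{k : c_{u_k} c_{u_{k+1}} < 0}`.  (Upper half: the distribution law, each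
window having `Var = [ends alternate]`; lower half: the intermediate value theorem on each alternating window,
`ExactPatchwork.card_alternating_le_card_posRoots`.)  Unlike `ExactPatchwork.card_posRoots_eq_card_alternating` no derivative
margin and only one dominance point per vertex is needed; interior exponents are excluded instead. [folklore] -/
theorem card_posRoots_eq_card_alternating_of_chain (f : ℝ[X]) (r : ℕ) (u : Fin (r + 1) → ℕ) (a : Fin (r + 1) → ℝ)
    (ha : StrictMono a) (ha0 : 0 < a 0)
    (hdom : ∀ k, ∑ i ∈ f.support.erase (u k), |f.coeff i| * a k ^ i < |f.coeff (u k)| * a k ^ (u k))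
    (hmin : ∀ s ∈ f.support, u 0 ≤ s) (hmax : ∀ s ∈ f.support, s ≤ u (Fin.last r))
    (hno : ∀ s ∈ f.support, ∀ k : Fin r, ¬ (u k.castSucc < s ∧ s < u k.succ)) :
    (f.roots.toFinset.filter (fun t => 0 < t)).card
      = (Finset.univ.filter (fun k : Fin r => f.coeff (u k.castSucc) * f.coeff (u k.succ) < 0)).card := by
  classical
  have hapos : ∀ k, 0 < a k := fun k => lt_of_lt_of_le ha0 (ha.monotone (Fin.zero_le _))
  have hcu : ∀ k, f.coeff (u k) ≠ 0 := fun k => coeff_ne_zero_of_dominant f (hapos k) (hdom k)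
  have hf : f ≠ 0 := fun h => hcu 0 (by rw [h, Polynomial.coeff_zero])
  refine le_antisymm ?_ ?_
  · refine (card_posRoots_le_sum_signVar f r u a ha ha0 hdom).trans (le_of_eq ?_)
    -- low part: `c_i = 0` below `u_0`
    have hlow : signVar ((List.range (u 0 + 1)).map f.coeff) = 0 := by
      rw [List.range_succ, List.map_append, List.map_singleton]
      rw [signVar_append_of_forall_eq_zero _ _ fun x hx => ?_]
      · exact signVar_single _
      · rw [List.mem_map] at hx
        obtain ⟨k, hk, rfl⟩ := hx
        rw [List.mem_range] at hk
        by_contra hne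
        exact absurd (hmin k (Polynomial.mem_support_iff.mpr hne)) (not_le.mpr hk)
    -- high part: the degree is `u_r`
    have hdeg : f.natDegree = u (Fin.last r) :=
      le_antisymm (hmax _ (Polynomial.natDegree_mem_support_of_nonzero hf)) (Polynomial.le_natDegree_of_ne_zero (hcu _))
    have hhigh : signVar ((List.range (f.natDegree + 1 - u (Fin.last r))).map (fun i => f.coeff (u (Fin.last r) + i))) = 0 := by
      rw [hdeg, Nat.add_sub_cancel_left]
      simp only [List.range_one, List.map_cons, List.map_nil, add_zero, signVar_single]
    -- windows: alternation indicators
    have hmid : ∀ k : Fin r, signVar ((List.range (u k.succ + 1 - u k.castSucc)).map (fun i => f.coeff (u k.castSucc + i)))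
        = if f.coeff (u k.castSucc) * f.coeff (u k.succ) < 0 then 1 else 0 := by
      intro k
      exact signVar_window_of_noInterior f
        (le_of_dominant_of_lt f (hapos _) (ha Fin.castSucc_lt_succ) (hdom _) (hdom _))
        (fun s hs => hno s hs k)
    rw [hlow, hhigh, zero_add, add_zero, Finset.sum_congr rfl (fun k _ => hmid k), Finset.card_filter]
  · exact card_alternating_le_card_posRoots f r u (fun k => a k.castSucc) (fun k => a k.succ)
      (fun k => hapos _) (fun k => (ha Fin.castSucc_lt_succ).le)
      (fun k k' hkk' => ha.monotone (Fin.succ_le_castSucc_iff.mpr hkk')) (fun k => hdom _) (fun k => hdom _)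

end Summit.ValiantsHypothesis.ValiantsHypothesis.Theorems.KPlusLogSqLaw.LocalDescartes
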